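import Literature.MathematicalPhysics.QuantumFieldTheory.Balaban1983to89.B9Eq388KhCommutatorLattice
import Literature.MathematicalPhysics.QuantumFieldTheory.Balaban1983to89.B9Eq3101ConjugationLettersChain

/-!
# `Balaban1983to89.B9Eq388KhLettersUnitWindow` — T. Bałaban, *Propagators for lattice gauge theories in a background field*, Commun. Math. Phys. **99**
# (1985) 389–434 [Balaban1985BackgroundPropagators] (3.88)–(3.89) p. 409 with (3.100)–(3.102) pp. 413–414, (3.19) p. 393, (3.23) p. 394: **PRINT's COMMUTATOR
# `K(h)` AT THE CHAIN's BACKGROUND LETTERS — the two near-field slots `ha` (`[Δ^η_U, θ]`, letters `a₁, a₀`) and `hb` (`Q̃′(U)θ − θ_FQ̃′(U)`, letter `b₀`) of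
# S-P6′(β) `B9Eq387CubeLocalisedProjection.norm_sub_projR_cube_le_nearfield` ∕ `B9Eq387CubeLocalisedProjectionLattice.norm_sub_projR_blockHull_le` INHABITED
# at the printed transporters `R(U(b))w = φ⁻¹(U(b)·φw·U(b)⁻¹)` in the UNIT WINDOW (`U(b) ∈ U₁`, `‖U(b) − 1‖ ≤ ε`, fibre reading `φ` with `M_φ, M_φ′`) for ONE
# REAL cut-off profile `σ` with slope letters `|σ(b₋) − σ(b₊)| ≤ ℓ₁η`, `|second differences| ≤ ℓ₂η²`:  `a₁ = √d·ℓ₁·(M_φM_φ′ + 1)`, `a₀ = d·ℓ₂`,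
# `b₀ = (1 + 2M_φM_φ′ε)^{d(L−1)}·d(L−1)·ℓ₁η` — η-FREE on the diagonal `Lη = 1`, no volume** — route R2′ STEP B7′∕B8′, S-P6′(β), instance-ledger row L10 (loc)

statement-level skeleton of published theorems with citation tags; proofs where landed; nothing here is a claim about the Yang–Mills mass gap

CITATION HEADER (lean-in-tree rule).  Audit cell `pub-balaban`, sub-cell `t4`, BINDER row NE9; filed by NE9 formalisation-swarm LEAF PROVER 05
(`b2b-balaban-t4-ne9-formalise-leaf-05`, gen 77) as the SUBSTITUTION BY NAME of this lineage's g74 (R) `B9Eq388KhCommutatorLattice.norm_lap_comm_le_etaFree`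
(`a₁, a₀` for abstract transporters `R, S` with `‖S_b‖ ≤ M_T`, `S_b∘R_b = 1`) and `norm_comm_T_single_le` (`b₀ = M_A√Θ` for an abstract `T` acting as the scalar
`Q′` (3.19)) at the chain's letters: `M_T := M_φM_φ′` (`B9Eq3101ConjugationLettersChain.norm_adTransportW_le` at `U(b)⁻¹ ∈ U₁`), `S_b∘R_b = 1`
(the identity of ne9-leaf-05 g76's (K6E) `B9Eq319BumpSectionBackgroundExact.adTransportW_inv_apply_adTransportW`, re-derived in two lines), `M_A := (1 + 2M_φM_φ′ε)^{d(L−1)}`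
(`B9Eq3101ConjugationLetters.norm_pathTr_contour_le` ∘ the OWNER's `B9Eq384RemainderLetters.norm_adTransportW_sub_le`), `T := (L²-reading)⁻¹ ∘ Q̃′(U)`
(`B9Eq3101ConjugationLettersChain.QprimeW_eq_QprimeLin`, `rfl`), the block oscillation `Θ := (d(L−1)·ℓ₁η)²` PRODUCED from the bond letter
(this lineage's g74 `B9Eq387IMSLocalLetterQprime.sum_sq_centre_sub_le_of_bond` at a singleton family).  CONSUMER BY SHAPE: ne9-leaf-06 g69's
`B9Eq387CubeLocalisedProjectionBumpSection.norm_sub_projR_blockHull_le_of_unitWindow_coercive` (its displayed `ha`, `hb`).  Source READ in the held text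
[Balaban1985BackgroundPropagators] (`paper:balaban1985-cmp99-background-propagators`): p. 409 (3.88) *«(Δ′_a h_□λ)(x) = h(x)(Δ′_aλ)(x) − (K(h)λ)(x)»*, (3.89)
*«|(K(h_□)G′_□h_□λ)(x)| ≤ O(M⁻¹)e^{−δ₀…}|λ|»*; p. 413 (3.100) *«the commutators [D*D, h] and [DD*, h] are first order differential operators with coefficients
determined by derivatives of the function h. They are of the order O(M⁻¹), or O(M⁻²), if considered on a proper scale»*; p. 414 (3.102).  NOTHING of these
estimates is asserted: the letters below are the cell's [folklore] bookkeeping of its own lattice objects.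

WHAT IS PROVED (sorry-free; proof lane — no `def`, no `Prop` placeholder; [folklore] substitution BY NAME).
* §1 **`norm_covLaplace_comm_le_unitWindow`** — the `ha` slot: `‖Δs(θu) − θ(Δs u)‖ ≤ √d·ℓ₁(M_φM_φ′ + 1)·‖D_Uu‖ + d·ℓ₂·‖u‖` for `Δs = Δ^η_U`, `D = D_U`
  (letters with defining equations), ANY lattice `Pd`, ANY `η > 0`.
* §2 `sq_centre_sub_le_of_bond` (the block oscillation of ONE profile from its bond letter), **`norm_Qprime_comm_le_unitWindow`** — the `hb` slot:
  `‖Q′(θu) − θ_F(Q′u)‖ ≤ (1 + 2M_φM_φ′ε)^{d(L−1)}·(d(L−1)·ℓ₁η)·‖u‖` for `θ_F` acting on the coarse carrier as `σ(L·y)` (block base point), `c₀L^d = c₁`;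
  **`norm_Qprime_comm_le_unitWindow_diagonal`** — on `Lη = 1`: `≤ (1 + 2M_φM_φ′ε)^{d(L−1)}·d·ℓ₁·‖u‖`.
HONEST SCOPE.  Two displayed hypotheses of ONE sub-step (S-P6′(β)) inhabited for ONE real profile; the profile itself (flat top near the support, zero off the
cube), the block decay of `1 − R(U)`, `c_P`, `C_Ψ` are NOT here (the consumer's other slots: ne9-leaf-06 g69 §3, ne9-leaf-01 g85 INTENT-6, (K6E)); `θ, θ_F` are
plain maps with pointwise action (inhabited by `B9Eq387IMSLocalLettersLattice.exists_pointwise_clm`).  NOT NE9 (cell pub-balaban: NE9 NOT PRINTED ∕ NOT PROVED;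
«NE9 ⇐ the named binders»; row WALLED ON A MODEL (O-NE9-1; #5 UNRULED); spine PROVED 0∕9; rung (B)+1 on a finite T⁴ — NOT infinite volume, NOT mass gap, NOT
Clay; HONEST DEPENDENCY: continuum YM on T⁴ ⇐ BetaPertH ∧ nine spine estimates (0/9 proved); BetaPertH ⇐ (D1) ∧ (D4) ∧ CAP+tail; G-an2-4 gates asym, D1 and
NE2/3/4).  NEW file; nothing modified.  Net new unproved facts: 0.
-/

noncomputable section

set_option autoImplicit false

open scoped InnerProductSpace BigOperators

namespace Literature.MathematicalPhysics.QuantumFieldTheory.Balaban1983to89.B9Eq388KhLettersUnitWindow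

open B4Sect5Torus (TSite)
open B9SectCLatticeCarrier (Bond bpos btgt shift unshift)
open B9Eq311L2Pairing (WL2)
open B9Eq323Ker (pathTr)
open B9Eq319QprimeTorus (fineP centre contour stepTransport QprimeLin)
open B11Eq103H1Complex (SiteL2K BondL2K covDerivL2K covDivL2K covLaplaceSiteK)
open B7Prop1Explicit (U1)
open B9Eq310HessianOperator (adTransportW adTransportW_apply)
open B9Eq326OperatorAssembly (QprimeW)
open B9Eq384RemainderLetters (norm_adTransportW_sub_le)
open B9Eq3101ConjugationLetters (norm_pathTr_contour_le)
open B9Eq3101ConjugationLettersChain (norm_adTransportW_le)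
open B9Eq388KhCommutatorLattice (norm_lap_comm_le_etaFree norm_comm_T_single_le)
open B9Eq387IMSLocalLetterQprime (sum_sq_centre_sub_le_of_bond)

variable {d : ℕ} {𝔸 : Type*} [NormedRing 𝔸] [NormedAlgebra ℂ 𝔸] [NormOneClass 𝔸]
  {W : Type*} [NormedAddCommGroup W] [InnerProductSpace ℂ W] (φ : W ≃ₗ[ℂ] 𝔸) {Mφ Mφ' : ℝ}
  (hMφ : 0 ≤ Mφ) (hφ : ∀ w, ‖φ w‖ ≤ Mφ * ‖w‖) (hMφ' : 0 ≤ Mφ') (hφ' : ∀ X, ‖φ.symm X‖ ≤ Mφ' * ‖X‖)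
  {c₀ : ℝ} [Fact (0 < c₀)]

/-! ## §1 The `ha` slot: `[Δ^η_U, θ]` for a real profile, η-free -/

section Laplace

variable {Pd : Fin d → ℕ} (U : Bond d Pd → 𝔸ˣ) (hU1 : ∀ b, U b ∈ U1 𝔸)

include hMφ hφ hMφ' hφ' hU1 in
/-- **THE `ha` SLOT OF S-P6′(β) IN THE UNIT WINDOW** ((3.88), (3.100) «O(M⁻¹), or O(M⁻²) … on a proper scale»): transporters `R(U(b))`, `R(U(b)⁻¹)` read on the
fibre through `φ` (`‖φw‖ ≤ M_φ‖w‖`, `‖φ⁻¹X‖ ≤ M_φ′‖X‖`), `U(b) ∈ U₁`, scaling `η⁻¹` with `0 < η`; `θ` acting on the fine sites as a REAL profile `σ` with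
`|σ(b₋) − σ(b₊)| ≤ ℓ₁η` on bonds and `|(σ(y) − σ(y−e_μ)) − (σ(y+e_μ) − σ(y))| ≤ ℓ₂η²`; `Δs = Δ^η_U = D_U*D_U`, `D = D_U` as letters with defining equations:
`‖Δs(θu) − θ(Δs u)‖ ≤ √d·ℓ₁·(M_φM_φ′ + 1)·‖Du‖ + d·ℓ₂·‖u‖` — `a₁ = √dℓ₁(M_φM_φ′ + 1)`, `a₀ = dℓ₂`, no `η`, no volume ((R) `norm_lap_comm_le_etaFree` with
`M_T := M_φM_φ′`, `S_b∘R_b = 1`). [folklore] [cite: Balaban1985BackgroundPropagators, (3.88) p.409, (3.100) p.413, (3.23) p.394] -/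
theorem norm_covLaplace_comm_le_unitWindow {η ℓ₁ ℓ₂ : ℝ} (hη : 0 < η) (hℓ₁ : 0 ≤ ℓ₁) (hℓ₂ : 0 ≤ ℓ₂) {σ : TSite d Pd → ℝ}
    (h1 : ∀ b : Bond d Pd, |σ (bpos b) - σ (btgt b)| ≤ ℓ₁ * η)
    (h2 : ∀ (y : TSite d Pd) (μ : Fin d), |(σ y - σ (unshift μ y)) - (σ (shift μ y) - σ y)| ≤ ℓ₂ * η ^ 2)
    (θ : SiteL2K ℂ d Pd c₀ W → SiteL2K ℂ d Pd c₀ W)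
    (hθ : ∀ (f : SiteL2K ℂ d Pd c₀ W) (x : TSite d Pd), WL2.equiv ℂ _ W (θ f) x = (σ x : ℂ) • WL2.equiv ℂ _ W f x)
    (D : SiteL2K ℂ d Pd c₀ W →ₗ[ℂ] BondL2K ℂ d Pd c₀ W) (hD : D = covDerivL2K ℂ c₀ ((η : ℂ))⁻¹ (adTransportW φ U))
    (Δs : SiteL2K ℂ d Pd c₀ W →ₗ[ℂ] SiteL2K ℂ d Pd c₀ W)
    (hΔs : Δs = covLaplaceSiteK ((η : ℂ))⁻¹ (adTransportW φ U) (adTransportW φ fun b => (U b)⁻¹))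
    (u : SiteL2K ℂ d Pd c₀ W) :
    ‖Δs (θ u) - θ (Δs u)‖ ≤ Real.sqrt d * (ℓ₁ * (Mφ * Mφ' + 1)) * ‖D u‖ + d * ℓ₂ * ‖u‖ := by
  have hMT : 0 ≤ Mφ * Mφ' := mul_nonneg hMφ hMφ'
  have hS : ∀ (b : Bond d Pd) (v : W), ‖adTransportW φ (fun b => (U b)⁻¹) b v‖ ≤ Mφ * Mφ' * ‖v‖ := fun b v =>
    norm_adTransportW_le φ hφ hφ' hMφ' (fun b => (U b)⁻¹) b ((U1 𝔸).inv_mem (hU1 b)) v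
  -- `S_b∘R_b = 1` on the fibre (= ne9-leaf-05 g76's (K6E) `B9Eq319BumpSectionBackgroundExact.adTransportW_inv_apply_adTransportW`; two lines of units
  -- algebra re-derived here so that this file's import closure stays at (R) + the chain letters)
  have hSR : ∀ (b : Bond d Pd) (v : W), adTransportW φ (fun b => (U b)⁻¹) b (adTransportW φ U b v) = v := fun b v => by
    rw [adTransportW_apply, adTransportW_apply, LinearEquiv.apply_symm_apply, inv_inv]
    have e : (((U b)⁻¹ : 𝔸ˣ) : 𝔸) * ((U b : 𝔸) * φ v * (((U b)⁻¹ : 𝔸ˣ) : 𝔸)) * (U b : 𝔸) = φ v := by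
      rw [← mul_assoc, ← mul_assoc, Units.inv_mul, one_mul, mul_assoc, Units.inv_mul, mul_one]
    rw [e, LinearEquiv.symm_apply_apply]
  -- the bond multiplier `σ(b₋)·` (built inside the proof; no definition)
  have hΘB : ∀ (A : BondL2K ℂ d Pd c₀ W) (b : Bond d Pd),
      WL2.equiv ℂ (fun _ : Bond d Pd => c₀) W
        ((WL2.equiv ℂ (fun _ : Bond d Pd => c₀) W).symm (fun b' => (σ (bpos b') : ℂ) • WL2.equiv ℂ (fun _ : Bond d Pd => c₀) W A b')) b =
        (σ (bpos b) : ℂ) • WL2.equiv ℂ (fun _ : Bond d Pd => c₀) W A b := fun A b => rfl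
  have h := norm_lap_comm_le_etaFree (𝕜 := ℂ) (c₀ := c₀) hη hℓ₁ hℓ₂ hMT hS hSR h1 h2 θ
    (fun A => (WL2.equiv ℂ (fun _ : Bond d Pd => c₀) W).symm (fun b' => (σ (bpos b') : ℂ) • WL2.equiv ℂ (fun _ : Bond d Pd => c₀) W A b'))
    hθ hΘB u
  rw [hΔs, hD]
  exact h

end Laplace

/-! ## §2 The `hb` slot: `Q̃′(U)θ − θ_FQ̃′(U)` for a real profile read at the block base points -/

section Averaging

variable (L : ℕ) [NeZero L] (m : Fin d → ℕ) {c₁ : ℝ} [Fact (0 < c₁)] (U : Bond d (fineP L m) → 𝔸ˣ) (hU1 : ∀ b, U b ∈ U1 𝔸)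

omit [NormOneClass 𝔸] in
/-- **THE BLOCK OSCILLATION OF ONE PROFILE FROM ITS BOND LETTER**: `|σ(b₋) − σ(b₊)| ≤ s` on every bond of the fine torus ⇒ `(σ(L·y) − σ(x))² ≤ (d(L−1)·s)²` for
`x ∈ B(y)` (`sum_sq_centre_sub_le_of_bond` at a singleton family: the block base point is joined to `x` by `≤ d(L−1)` unit bonds). [folklore]
[cite: Balaban1984PropagatorsI, (1.7) p.18; Balaban1985BackgroundPropagators, p.414] -/
theorem sq_centre_sub_le_of_bond {σ : TSite d (fineP L m) → ℝ} {s : ℝ} (h1 : ∀ b : Bond d (fineP L m), |σ (bpos b) - σ (btgt b)| ≤ s)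
    (y : TSite d m) (x : TSite d (fineP L m)) (hx : x ∈ B9Eq319QprimeTorus.blockOf L m y) :
    (σ (centre L m y) - σ x) ^ 2 ≤ ((d : ℝ) * ((L : ℝ) - 1) * s) ^ 2 := by
  have hb : ∀ b : Bond d (fineP L m), ∑ _j ∈ (Finset.univ : Finset Unit), (σ (bpos b) - σ (btgt b)) ^ 2 ≤ s ^ 2 := fun b => by
    rw [Finset.sum_const, Finset.card_univ, Fintype.card_unit, one_smul, ← sq_abs]
    exact pow_le_pow_left₀ (abs_nonneg _) (h1 b) 2
  have h := sum_sq_centre_sub_le_of_bond L m (Finset.univ : Finset Unit) (fun _ => σ) (sq_nonneg s) hb y x hx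
  rw [Finset.sum_const, Finset.card_univ, Fintype.card_unit, one_smul] at h
  rw [mul_pow]
  exact h

include hMφ hφ hMφ' hφ' hU1 in
/-- **THE `hb` SLOT OF S-P6′(β) IN THE UNIT WINDOW** ((3.88) with (3.102), (3.19)): `Q′ = (L²-reading)⁻¹ ∘ Q̃′(U)` (a letter with defining equation), `θ` acting on
the fine sites as a REAL profile `σ` with `|σ(b₋) − σ(b₊)| ≤ ℓ₁η`, `θ_F` acting on the coarse sites as `σ(L·y)` (the block base point), `U(b) ∈ U₁`,
`‖U(b) − 1‖ ≤ ε`, canonical weights `c₀L^d = c₁`:  `‖Q′(θu) − θ_F(Q′u)‖ ≤ (1 + 2M_φM_φ′ε)^{d(L−1)}·(d(L−1)·ℓ₁η)·‖u‖` ((R) `norm_comm_T_single_le` with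
`M_A := (1 + 2M_φM_φ′ε)^{d(L−1)}` — `norm_pathTr_contour_le` ∘ `norm_adTransportW_sub_le` —, `Θ := (d(L−1)ℓ₁η)²`). [folklore]
[cite: Balaban1985BackgroundPropagators, (3.88) p.409, (3.102) p.414, (3.19) p.393] -/
theorem norm_Qprime_comm_le_unitWindow {ε η ℓ₁ : ℝ} (hε : 0 ≤ ε) (hUε : ∀ b, ‖(U b : 𝔸) - 1‖ ≤ ε) (hη : 0 ≤ η) (hℓ₁ : 0 ≤ ℓ₁)
    (hc : c₀ * (L : ℝ) ^ d = c₁) {σ : TSite d (fineP L m) → ℝ} (h1 : ∀ b : Bond d (fineP L m), |σ (bpos b) - σ (btgt b)| ≤ ℓ₁ * η)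
    (θ : SiteL2K ℂ d (fineP L m) c₀ W → SiteL2K ℂ d (fineP L m) c₀ W)
    (hθ : ∀ (f : SiteL2K ℂ d (fineP L m) c₀ W) (x : TSite d (fineP L m)), WL2.equiv ℂ _ W (θ f) x = (σ x : ℂ) • WL2.equiv ℂ _ W f x)
    (θF : SiteL2K ℂ d m c₁ W → SiteL2K ℂ d m c₁ W)
    (hθF : ∀ (g : SiteL2K ℂ d m c₁ W) (y : TSite d m), WL2.equiv ℂ _ W (θF g) y = (σ (centre L m y) : ℂ) • WL2.equiv ℂ _ W g y)
    (Q' : SiteL2K ℂ d (fineP L m) c₀ W →ₗ[ℂ] SiteL2K ℂ d m c₁ W)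
    (hQ' : Q' = (WL2.linearEquiv ℂ ℂ (fun _ : TSite d m => c₁)).symm.toLinearMap ∘ₗ QprimeW L m φ U (c₀ := c₀))
    (u : SiteL2K ℂ d (fineP L m) c₀ W) :
    ‖Q' (θ u) - θF (Q' u)‖ ≤ (1 + 2 * Mφ * Mφ' * ε) ^ (d * (L - 1)) * ((d : ℝ) * ((L : ℝ) - 1) * (ℓ₁ * η)) * ‖u‖ := by
  have hεR : 0 ≤ 2 * Mφ * Mφ' * ε := by positivity
  have hR : ∀ (b : Bond d (fineP L m)) (v : W), ‖adTransportW φ U b v - v‖ ≤ 2 * Mφ * Mφ' * ε * ‖v‖ := fun b v =>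
    norm_adTransportW_sub_le φ hφ hφ' hMφ' U b (hU1 b) (hUε b) v
  have hA : ∀ (y : TSite d m), ∀ x ∈ B9Eq319QprimeTorus.blockOf L m y, ∀ v : W,
      ‖pathTr (stepTransport L m fun b => (adTransportW φ U b).restrictScalars ℝ) (centre L m y :: contour L m x) v‖ ≤
        (1 + 2 * Mφ * Mφ' * ε) ^ (d * (L - 1)) * ‖v‖ := fun y x _ v => norm_pathTr_contour_le L m (adTransportW φ U) hεR hR y x v
  have hT : ∀ (f : SiteL2K ℂ d (fineP L m) c₀ W) (y : TSite d m),
      WL2.equiv ℂ (fun _ : TSite d m => c₁) W (Q' f) y = QprimeLin L m (adTransportW φ U) (WL2.equiv ℂ (fun _ : TSite d (fineP L m) => c₀) W f) y :=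
    fun f y => by rw [hQ']; rfl
  have hL1 : (1 : ℝ) ≤ (L : ℝ) := by exact_mod_cast NeZero.one_le
  have hs : 0 ≤ (d : ℝ) * ((L : ℝ) - 1) * (ℓ₁ * η) := by
    have : (0 : ℝ) ≤ (L : ℝ) - 1 := sub_nonneg.2 hL1
    positivity
  have hΘ : ∀ (y : TSite d m), ∀ x ∈ B9Eq319QprimeTorus.blockOf L m y,
      ((fun y => σ (centre L m y)) y - σ x) ^ 2 ≤ ((d : ℝ) * ((L : ℝ) - 1) * (ℓ₁ * η)) ^ 2 := fun y x hx =>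
    sq_centre_sub_le_of_bond L m h1 y x hx
  have hc' : c₁ = (L : ℝ) ^ d * c₀ := by rw [← hc, mul_comm]
  have h := norm_comm_T_single_le L m hA Q' hT hΘ θ θF hθ hθF (by positivity) (sq_nonneg _) hc' u
  rwa [Real.sqrt_sq hs] at h

include hMφ hφ hMφ' hφ' hU1 in
/-- **THE `hb` SLOT ON THE DIAGONAL `Lη = 1`**: as `norm_Qprime_comm_le_unitWindow`, with `d(L−1)·ℓ₁η ≤ d·ℓ₁` — `b₀ = (1 + 2M_φM_φ′ε)^{d(L−1)}·d·ℓ₁`, no `η`, no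
volume («O(M⁻¹) on a proper scale»). [folklore] [cite: Balaban1985BackgroundPropagators, (3.88)–(3.89) p.409, (3.102) p.414, (3.19) p.393] -/
theorem norm_Qprime_comm_le_unitWindow_diagonal {ε η ℓ₁ : ℝ} (hε : 0 ≤ ε) (hUε : ∀ b, ‖(U b : 𝔸) - 1‖ ≤ ε) (hLη : (L : ℝ) * η = 1) (hℓ₁ : 0 ≤ ℓ₁)
    (hc : c₀ * (L : ℝ) ^ d = c₁) {σ : TSite d (fineP L m) → ℝ} (h1 : ∀ b : Bond d (fineP L m), |σ (bpos b) - σ (btgt b)| ≤ ℓ₁ * η)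
    (θ : SiteL2K ℂ d (fineP L m) c₀ W → SiteL2K ℂ d (fineP L m) c₀ W)
    (hθ : ∀ (f : SiteL2K ℂ d (fineP L m) c₀ W) (x : TSite d (fineP L m)), WL2.equiv ℂ _ W (θ f) x = (σ x : ℂ) • WL2.equiv ℂ _ W f x)
    (θF : SiteL2K ℂ d m c₁ W → SiteL2K ℂ d m c₁ W)
    (hθF : ∀ (g : SiteL2K ℂ d m c₁ W) (y : TSite d m), WL2.equiv ℂ _ W (θF g) y = (σ (centre L m y) : ℂ) • WL2.equiv ℂ _ W g y)
    (Q' : SiteL2K ℂ d (fineP L m) c₀ W →ₗ[ℂ] SiteL2K ℂ d m c₁ W)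
    (hQ' : Q' = (WL2.linearEquiv ℂ ℂ (fun _ : TSite d m => c₁)).symm.toLinearMap ∘ₗ QprimeW L m φ U (c₀ := c₀))
    (u : SiteL2K ℂ d (fineP L m) c₀ W) :
    ‖Q' (θ u) - θF (Q' u)‖ ≤ (1 + 2 * Mφ * Mφ' * ε) ^ (d * (L - 1)) * (d * ℓ₁) * ‖u‖ := by
  have hL0 : (0 : ℝ) < (L : ℝ) := by exact_mod_cast NeZero.pos L
  have hη : 0 ≤ η := by
    have : η = 1 / (L : ℝ) := by rw [eq_div_iff hL0.ne', mul_comm]; exact hLη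
    rw [this]; positivity
  have h := norm_Qprime_comm_le_unitWindow φ hMφ hφ hMφ' hφ' L m U hU1 hε hUε hη hℓ₁ hc h1 θ hθ θF hθF Q' hQ' u
  refine h.trans (mul_le_mul_of_nonneg_right (mul_le_mul_of_nonneg_left ?_ (by positivity)) (norm_nonneg _))
  -- `d(L−1)·ℓ₁η ≤ d·ℓ₁` from `(L−1)η ≤ Lη = 1`
  have hLe : ((L : ℝ) - 1) * η ≤ 1 := by nlinarith
  calc (d : ℝ) * ((L : ℝ) - 1) * (ℓ₁ * η) = (d : ℝ) * ℓ₁ * (((L : ℝ) - 1) * η) := by ring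
    _ ≤ (d : ℝ) * ℓ₁ * 1 := mul_le_mul_of_nonneg_left hLe (by positivity)
    _ = d * ℓ₁ := mul_one _

end Averaging

end Literature.MathematicalPhysics.QuantumFieldTheory.Balaban1983to89.B9Eq388KhLettersUnitWindow

end
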